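import Summits.CriticalPhenomena.PercolationContinuityZ3.Theorems.SahiAEVersionTransportPrelim
import Mathlib.MeasureTheory.Function.Jacobian
import Mathlib.MeasureTheory.Measure.WithDensityFinite
import Mathlib.Analysis.SpecialFunctions.Sigmoid

/-!
# Transport of Borel everywhere-MTP₂ versions: from Lebesgue measure to products of atomless measures

Support file of the Sahi cell (`prim-sahi`, typer seat, generation 21; `--supports stmt-CriticalPhenomena-4575`).

Plan R5 of the cell (lit g34/g35, typer g20/g21) produces, for LEBESGUE measure on `ℝ^ι`, a Borel version `F` of
every measurable density `f` with `0 < c ≤ f ≤ M < ∞` that is MTP₂ on almost every pair, with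
`F(x) F(y) ≤ F(x ∧ y) F(x ∨ y)` at EVERY pair (`SahiAECornerEnvelope.lean` = the envelope step; the separable tilt and the
assembly are separate files).  This file is the TRANSPORT of that property to other reference measures; it does not use
the Lebesgue theorem itself (which enters only as the hypothesis `HasBorelMTP2Versions volume` of the final
implications), so everything here is unconditional.

* `HasBorelMTP2Versions μ` — the property of a reference measure `μ` on a measurable lattice: every measurable
  `f : α → [c, M]` (`0 < c`, `M < ∞`) which is MTP₂ on `μ ⊗ μ`-a.e. pair has a measurable version MTP₂ at every pair.
* `HasBorelMTP2Versions.transport` — the abstract transport lemma along a pair of measurable maps `T : α → β`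
  (an a.e. lattice homomorphism with `T_* μ ∼ ν`) and `R : β → α` (a lattice homomorphism on a full-measure
  sublattice `S`, with `R ∘ T = id` `μ`-a.e.): `f ↦ f ∘ T`, `F' ↦ 𝟙_S · (F' ∘ R)`.
* `HasBorelMTP2Versions.of_equivalent` (equivalent measures), `hasBorelMTP2Versions_zero`.
* `HasBorelMTP2Versions.restrict_openUnitCube` — Lebesgue on `ℝ^ι` ⟹ Lebesgue on the open unit cube `(0,1)^ι`
  (coordinatewise sigmoid / logit; null sets are preserved both ways by
  `addHaar_image_eq_zero_of_differentiableOn_of_addHaar_eq_zero`).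
* `HasBorelMTP2Versions.pi_of_restrict_openUnitCube` — Lebesgue on `(0,1)^ι` ⟹ `⊗ᵢ νᵢ` for atomless PROBABILITY
  measures `νᵢ` on `ℝ` (coordinatewise quantile `RealQuantile.rq`, measure-preserving from `λ|(0,1)` to `νᵢ`; for an
  atomless law the distribution function is continuous, so `cdf ∘ quantile = id` on `(0,1)` POINTWISE, and the
  pull-back `F' ∘ cdf^⊗` of an everywhere-MTP₂ function along the everywhere-monotone map `cdf^⊗` is everywhere-MTP₂).
* `HasBorelMTP2Versions.pi_of_volume` — Lebesgue on `ℝ^ι` ⟹ `Measure.pi ρ` for every finite family of atomless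
  σ-finite measures `ρᵢ` on `ℝ` (via `Measure.toFinite`, an equivalent probability measure, and
  `pi_absolutelyContinuous_pi`); unfolded: `exists_measurable_mtp2_version_of_ae_pi_of_volume`.

What is NOT claimed: reference measures with atoms mixed with a diffuse part (open); purely atomic products are
trivial and not treated.  No sorries, no new axioms.
-/

noncomputable section

namespace Summit.CriticalPhenomena.PercolationContinuityZ3.Theorems.SahiAEFourFunctions

open MeasureTheory Set Filter Topology ProbabilityTheory
open scoped ENNReal NNReal

/-! ### The property and its transport -/

section Transport

/-- **The Borel-version property** of a reference measure `μ` on a measurable lattice `α`: every measurable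
`f : α → [0,∞]` with `0 < c ≤ f ≤ M < ∞` which is MTP₂ (`f(x) f(y) ≤ f(x ∧ y) f(x ∨ y)`) for `μ ⊗ μ`-almost every
pair `(x, y)` has a bounded measurable version `F = f` `μ`-a.e. which is MTP₂ at EVERY pair. [this work] -/
def HasBorelMTP2Versions {α : Type*} [MeasurableSpace α] [Lattice α] (μ : Measure α) : Prop :=
  ∀ (f : α → ℝ≥0∞), Measurable f → ∀ (c M : ℝ≥0∞), c ≠ 0 → M ≠ ∞ → (∀ x, c ≤ f x) → (∀ x, f x ≤ M) →
    (∀ᵐ p ∂μ.prod μ, f p.1 * f p.2 ≤ f (p.1 ⊓ p.2) * f (p.1 ⊔ p.2)) →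
    ∃ F : α → ℝ≥0∞, Measurable F ∧ (∃ M' : ℝ≥0∞, M' ≠ ∞ ∧ ∀ x, F x ≤ M') ∧ F =ᵐ[μ] f ∧
      ∀ x y, F x * F y ≤ F (x ⊓ y) * F (x ⊔ y)

variable {α β : Type*} [MeasurableSpace α] [MeasurableSpace β] [Lattice α] [Lattice β]

/-- **Transport lemma.**  Let `T : α → β`, `R : β → α` be measurable, `T` a lattice homomorphism on `μ ⊗ μ`-almost
every pair, `ν ≪ T_* μ ≪ ν`, `S ⊆ β` a measurable sublattice of full `ν`-measure on which `R` is a lattice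
homomorphism, and `R (T x) = x` for `μ`-a.e. `x`.  If `μ` has the Borel-version property, so does `ν`: the version of
`f` is `𝟙_S · (F' ∘ R)` where `F'` is a version of `f ∘ T`. [this work] -/
theorem HasBorelMTP2Versions.transport {μ : Measure α} {ν : Measure β} [SFinite μ] [SFinite ν]
    (hP : HasBorelMTP2Versions μ) {T : α → β} {R : β → α} (hT : Measurable T) (hR : Measurable R)
    (hTlat : ∀ᵐ p ∂μ.prod μ, T (p.1 ⊓ p.2) = T p.1 ⊓ T p.2 ∧ T (p.1 ⊔ p.2) = T p.1 ⊔ T p.2)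
    (hνT : ν ≪ μ.map T) (hTν : μ.map T ≪ ν) {S : Set β} (hS : MeasurableSet S) (hνS : ν Sᶜ = 0)
    (hSinf : ∀ x ∈ S, ∀ y ∈ S, x ⊓ y ∈ S) (hSsup : ∀ x ∈ S, ∀ y ∈ S, x ⊔ y ∈ S)
    (hRlat : ∀ x ∈ S, ∀ y ∈ S, R (x ⊓ y) = R x ⊓ R y ∧ R (x ⊔ y) = R x ⊔ R y)
    (hRT : ∀ᵐ x ∂μ, R (T x) = x) : HasBorelMTP2Versions ν := by
  intro f hf c M hc hM hcf hfM hMTP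
  -- the pulled-back density `f ∘ T`
  have hqmp : Measure.QuasiMeasurePreserving T μ ν := ⟨hT, hTν⟩
  have hqmp2 : Measure.QuasiMeasurePreserving (Prod.map T T) (μ.prod μ) (ν.prod ν) :=
    MeasureTheory.QuasiMeasurePreserving.prodMap hqmp hqmp
  have hMTP' : ∀ᵐ p ∂μ.prod μ, f (T p.1) * f (T p.2) ≤ f (T (p.1 ⊓ p.2)) * f (T (p.1 ⊔ p.2)) := by
    filter_upwards [hqmp2.ae hMTP, hTlat] with p hp hl
    rw [hl.1, hl.2]
    exact hp
  obtain ⟨F', hF'm, ⟨M', hM', hF'M'⟩, hF'ae, hF'mtp⟩ :=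
    hP (f ∘ T) (hf.comp hT) c M hc hM (fun x => hcf (T x)) (fun x => hfM (T x)) hMTP'
  refine ⟨S.indicator (F' ∘ R), (hF'm.comp hR).indicator hS, ⟨M', hM', fun x => ?_⟩, ?_, fun x y => ?_⟩
  · by_cases hx : x ∈ S
    · rw [Set.indicator_of_mem hx]; exact hF'M' (R x)
    · rw [Set.indicator_of_notMem hx]; exact zero_le
  · -- `𝟙_S · (F' ∘ R) = f` `ν`-a.e.
    have h1 : ∀ᵐ x ∂μ, F' (R (T x)) = f (T x) := by
      filter_upwards [hF'ae, hRT] with x hx hxR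
      rw [hxR]; exact hx
    have h2 : ∀ᵐ y ∂μ.map T, F' (R y) = f y :=
      (ae_map_iff hT.aemeasurable (measurableSet_eq_fun (hF'm.comp hR) hf)).2 h1
    have h3 : ∀ᵐ y ∂ν, F' (R y) = f y := hνT.ae_le h2
    have h4 : ∀ᵐ y ∂ν, y ∈ S := by
      rw [ae_iff]; simpa only [← Set.compl_setOf, Set.setOf_mem_eq] using hνS
    filter_upwards [h3, h4] with y hy hyS
    simp only [Set.indicator_of_mem hyS, Function.comp_apply, hy]
  · -- MTP₂ at every pair
    by_cases hx : x ∈ S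
    · by_cases hy : y ∈ S
      · rw [Set.indicator_of_mem hx, Set.indicator_of_mem hy, Set.indicator_of_mem (hSinf x hx y hy),
          Set.indicator_of_mem (hSsup x hx y hy)]
        simp only [Function.comp_apply]
        rw [(hRlat x hx y hy).1, (hRlat x hx y hy).2]
        exact hF'mtp (R x) (R y)
      · rw [Set.indicator_of_notMem hy, mul_zero]; exact zero_le
    · rw [Set.indicator_of_notMem hx, zero_mul]; exact zero_le

/-- Equivalent reference measures have the Borel-version property simultaneously. [this work] -/
theorem HasBorelMTP2Versions.of_equivalent {μ ν : Measure α} [SFinite μ] [SFinite ν] (hP : HasBorelMTP2Versions μ)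
    (hνμ : ν ≪ μ) (hμν : μ ≪ ν) : HasBorelMTP2Versions ν := by
  refine hP.transport (T := id) (R := id) measurable_id measurable_id (Eventually.of_forall fun p => ⟨rfl, rfl⟩)
    (by rwa [Measure.map_id]) (by rwa [Measure.map_id]) MeasurableSet.univ (by simp) (fun _ _ _ _ => mem_univ _)
    (fun _ _ _ _ => mem_univ _) (fun _ _ _ _ => ⟨rfl, rfl⟩) (Eventually.of_forall fun _ => rfl)

/-- The zero measure has the property trivially (the constant version). [folklore] -/
theorem hasBorelMTP2Versions_zero : HasBorelMTP2Versions (0 : Measure α) := by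
  intro f _ c M _ hM hcf hfM _
  exact ⟨fun _ => c, measurable_const, ⟨M, hM, fun x => (hcf x).trans (hfM x)⟩, ae_zero.le (by simp),
    fun _ _ => le_rfl⟩

end Transport

/-! ### Finite products of absolutely continuous measures (plumbing) -/

section PiAC

variable {γ : Type*} [MeasurableSpace γ]

/-- `Fin n`-indexed products of absolutely continuous σ-finite measures are absolutely continuous. [folklore]
(adapted from `Literature/MathematicalPhysics/QuantumFieldTheory/Balaban1983to89/T4TriangularPushforward.lean`) -/
private theorem pi_absolutelyContinuous_pi_fin {n : ℕ} {μ ν : Fin n → Measure γ} [∀ i, SigmaFinite (μ i)]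
    [∀ i, SigmaFinite (ν i)] (h : ∀ i, ν i ≪ μ i) : Measure.pi ν ≪ Measure.pi μ := by
  induction n with
  | zero =>
      rw [Measure.pi_of_empty μ, Measure.pi_of_empty ν]
  | succ n ih =>
      have hμ := measurePreserving_piFinSuccAbove μ 0
      have hν := measurePreserving_piFinSuccAbove ν 0
      have ih' : Measure.pi (fun j => ν (Fin.succAbove 0 j)) ≪ Measure.pi (fun j => μ (Fin.succAbove 0 j)) :=
        ih (fun j => h _)
      have hprod : (ν 0).prod (Measure.pi fun j => ν (Fin.succAbove 0 j)) ≪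
          (μ 0).prod (Measure.pi fun j => μ (Fin.succAbove 0 j)) := (h 0).prod ih'
      have := hprod.map (MeasurableEquiv.piFinSuccAbove (fun _ : Fin (n+1) => γ) 0).symm.measurable
      rwa [(hν.symm _).map_eq, (hμ.symm _).map_eq] at this

/-- Finite products of absolutely continuous σ-finite measures are absolutely continuous. [folklore]
(adapted from the same file) -/
private theorem pi_absolutelyContinuous_pi {ι : Type*} [Fintype ι] {μ ν : ι → Measure γ}
    [∀ i, SigmaFinite (μ i)] [∀ i, SigmaFinite (ν i)] (h : ∀ i, ν i ≪ μ i) : Measure.pi ν ≪ Measure.pi μ := by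
  set e := (Fintype.equivFin ι).symm with he
  have hμ := measurePreserving_piCongrLeft μ e
  have hν := measurePreserving_piCongrLeft ν e
  have hfin : Measure.pi (fun i' => ν (e i')) ≪ Measure.pi (fun i' => μ (e i')) :=
    pi_absolutelyContinuous_pi_fin (fun i' => h _)
  have := hfin.map (MeasurableEquiv.piCongrLeft (fun _ : ι => γ) e).measurable
  rwa [hν.map_eq, hμ.map_eq] at this

end PiAC

/-! ### From Lebesgue measure on `ℝ^ι` to Lebesgue measure on the open unit cube -/

section OpenCube

variable {ι : Type*} [Fintype ι]

/-- `sigmoid (log (v * (1 - v)⁻¹)) = v` on `(0,1)`. [folklore] -/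
private theorem sigmoid_log_div {v : ℝ} (hv : v ∈ Ioo (0 : ℝ) 1) : Real.sigmoid (Real.log (v * (1 - v)⁻¹)) = v := by
  have hv0 : 0 < v := hv.1
  have hv1 : 0 < 1 - v := by linarith [hv.2]
  rw [Real.sigmoid_def, Real.exp_neg, Real.exp_log (mul_pos hv0 (inv_pos.2 hv1))]
  field_simp
  ring

/-- `log (sigmoid x / (1 - sigmoid x)) = x`. [folklore] -/
private theorem log_div_sigmoid (x : ℝ) : Real.log (Real.sigmoid x * (1 - Real.sigmoid x)⁻¹) = x :=
  Real.sigmoid_injective (sigmoid_log_div ⟨Real.sigmoid_pos x, Real.sigmoid_lt_one x⟩)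

/-- The coordinatewise logit is monotone on the open unit cube, coordinate by coordinate. [folklore] -/
private theorem log_div_le_log_div {u v : ℝ} (hu : u ∈ Ioo (0 : ℝ) 1) (hv : v ∈ Ioo (0 : ℝ) 1) (huv : u ≤ v) :
    Real.log (u * (1 - u)⁻¹) ≤ Real.log (v * (1 - v)⁻¹) := by
  rw [← Real.sigmoid_le_iff, sigmoid_log_div hu, sigmoid_log_div hv]
  exact huv

/-- **Lebesgue on `ℝ^ι` ⟹ Lebesgue on the open unit cube.**  Transport along the coordinatewise sigmoid
`e : ℝ^ι → (0,1)^ι` (a lattice isomorphism) and its inverse, the coordinatewise logit: both are differentiable (the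
logit on the open cube), so they map Lebesgue-null sets to Lebesgue-null sets
(`addHaar_image_eq_zero_of_differentiableOn_of_addHaar_eq_zero`), i.e. `e_* λ` and `λ|_{(0,1)^ι}` are equivalent.
[this work] -/
theorem HasBorelMTP2Versions.restrict_openUnitCube (hP : HasBorelMTP2Versions (volume : Measure (ι → ℝ))) :
    HasBorelMTP2Versions ((volume : Measure (ι → ℝ)).restrict (Set.pi univ fun _ => Ioo (0 : ℝ) 1)) := by
  set U : Set (ι → ℝ) := Set.pi univ fun _ => Ioo (0 : ℝ) 1 with hU
  have mU : MeasurableSet U := MeasurableSet.univ_pi fun _ => measurableSet_Ioo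
  set e : (ι → ℝ) → (ι → ℝ) := fun x i => Real.sigmoid (x i) with he
  set L : (ι → ℝ) → (ι → ℝ) := fun y i => Real.log (y i * (1 - y i)⁻¹) with hL
  have he_meas : Measurable e :=
    measurable_pi_iff.2 fun i => continuous_sigmoid.measurable.comp (measurable_pi_apply i)
  have hL_meas : Measurable L :=
    measurable_pi_iff.2 fun i => Real.measurable_log.comp
      ((measurable_pi_apply i).mul (measurable_const.sub (measurable_pi_apply i)).inv)
  have he_mem : ∀ x, e x ∈ U := fun x => Set.mem_univ_pi.2 fun i => ⟨Real.sigmoid_pos _, Real.sigmoid_lt_one _⟩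
  have hLe : ∀ x, L (e x) = x := fun x => funext fun i => log_div_sigmoid (x i)
  have heL : ∀ y ∈ U, e (L y) = y := fun y hy => funext fun i => sigmoid_log_div (Set.mem_univ_pi.1 hy i)
  -- differentiability
  have he_diff : Differentiable ℝ e :=
    differentiable_pi.2 fun i => differentiable_sigmoid.comp (differentiable_apply i)
  have hL_diff : DifferentiableOn ℝ L U := by
    refine differentiableOn_pi.2 fun i => ?_
    have h1 : DifferentiableOn ℝ (fun y : ι → ℝ => y i) U := (differentiable_apply i).differentiableOn
    have h2 : DifferentiableOn ℝ (fun y : ι → ℝ => 1 - y i) U :=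
      ((differentiable_const (1 : ℝ)).sub (differentiable_apply i)).differentiableOn
    refine (h1.mul (h2.inv fun y hy => ?_)).log fun y hy => ?_
    · have := (Set.mem_univ_pi.1 hy i).2; linarith
    · have h0 := (Set.mem_univ_pi.1 hy i).1
      have h1' : 0 < 1 - y i := by have := (Set.mem_univ_pi.1 hy i).2; linarith
      exact (mul_pos h0 (inv_pos.2 h1')).ne'
  -- the two absolute continuities
  have hν : (volume : Measure (ι → ℝ)).restrict U ≪ (volume : Measure (ι → ℝ)).map e := by
    refine Measure.AbsolutelyContinuous.mk fun s hs h0 => ?_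
    rw [Measure.map_apply he_meas hs] at h0
    rw [Measure.restrict_apply hs]
    have hsub : s ∩ U ⊆ e '' (e ⁻¹' s) := fun y hy => ⟨L y, by
      show e (L y) ∈ s
      rw [heL y hy.2]; exact hy.1, heL y hy.2⟩
    exact measure_mono_null hsub
      (addHaar_image_eq_zero_of_differentiableOn_of_addHaar_eq_zero volume he_diff.differentiableOn h0)
  have hν' : (volume : Measure (ι → ℝ)).map e ≪ (volume : Measure (ι → ℝ)).restrict U := by
    refine Measure.AbsolutelyContinuous.mk fun s hs h0 => ?_
    rw [Measure.restrict_apply hs] at h0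
    rw [Measure.map_apply he_meas hs]
    have hsub : e ⁻¹' s ⊆ L '' (s ∩ U) := fun x hx => ⟨e x, ⟨hx, he_mem x⟩, hLe x⟩
    exact measure_mono_null hsub
      (addHaar_image_eq_zero_of_differentiableOn_of_addHaar_eq_zero volume
        (hL_diff.mono Set.inter_subset_right) h0)
  -- lattice properties
  have hUinf : ∀ x ∈ U, ∀ y ∈ U, x ⊓ y ∈ U := fun x hx y hy => Set.mem_univ_pi.2 fun i =>
    ⟨lt_min (Set.mem_univ_pi.1 hx i).1 (Set.mem_univ_pi.1 hy i).1,
      (min_le_left _ _).trans_lt (Set.mem_univ_pi.1 hx i).2⟩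
  have hUsup : ∀ x ∈ U, ∀ y ∈ U, x ⊔ y ∈ U := fun x hx y hy => Set.mem_univ_pi.2 fun i =>
    ⟨(Set.mem_univ_pi.1 hx i).1.trans_le (le_max_left _ _),
      max_lt (Set.mem_univ_pi.1 hx i).2 (Set.mem_univ_pi.1 hy i).2⟩
  have helat : ∀ x y, e (x ⊓ y) = e x ⊓ e y ∧ e (x ⊔ y) = e x ⊔ e y := fun x y =>
    ⟨funext fun i => Real.sigmoid_monotone.map_inf (x i) (y i),
      funext fun i => Real.sigmoid_monotone.map_sup (x i) (y i)⟩
  have hLlat : ∀ x ∈ U, ∀ y ∈ U, L (x ⊓ y) = L x ⊓ L y ∧ L (x ⊔ y) = L x ⊔ L y := by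
    intro x hx y hy
    have hmono : MonotoneOn (fun v : ℝ => Real.log (v * (1 - v)⁻¹)) (Ioo (0 : ℝ) 1) :=
      fun u hu v hv huv => log_div_le_log_div hu hv huv
    refine ⟨funext fun i => ?_, funext fun i => ?_⟩
    · exact hmono.map_inf (Set.mem_univ_pi.1 hx i) (Set.mem_univ_pi.1 hy i)
    · exact hmono.map_sup (Set.mem_univ_pi.1 hx i) (Set.mem_univ_pi.1 hy i)
  have hUc : ((volume : Measure (ι → ℝ)).restrict U) Uᶜ = 0 := by
    rw [Measure.restrict_apply mU.compl, Set.compl_inter_self, measure_empty]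
  exact hP.transport he_meas hL_meas (Eventually.of_forall fun p => helat p.1 p.2) hν hν' mU hUc hUinf hUsup hLlat
    (Eventually.of_forall hLe)

end OpenCube

/-! ### From Lebesgue measure on the open unit cube to products of atomless probability measures -/

section Quantile

open RealQuantile

variable {ι : Type*} [Fintype ι]

/-- **Lebesgue on the open unit cube ⟹ every product of atomless probability measures on `ℝ`.**  Transport along
the coordinatewise quantile map `(0,1)^ι → ℝ^ι` (measure preserving, monotone on the cube) and the coordinatewise
distribution function `ℝ^ι → [0,1]^ι` (monotone everywhere; `cdf ∘ quantile = id` on `(0,1)` for atomless laws).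
[this work] -/
theorem HasBorelMTP2Versions.pi_of_restrict_openUnitCube
    (hP : HasBorelMTP2Versions ((volume : Measure (ι → ℝ)).restrict (Set.pi univ fun _ => Ioo (0 : ℝ) 1)))
    (ν : ι → Measure ℝ) [∀ i, IsProbabilityMeasure (ν i)] [∀ i, NullSingletonClass (ν i)] :
    HasBorelMTP2Versions (Measure.pi ν) := by
  set U : Set (ι → ℝ) := Set.pi univ fun _ => Ioo (0 : ℝ) 1 with hU
  have mU : MeasurableSet U := MeasurableSet.univ_pi fun _ => measurableSet_Ioo
  set μ₁ : Measure (ι → ℝ) := (volume : Measure (ι → ℝ)).restrict U with hμ₁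
  have hμ₁pi : μ₁ = Measure.pi fun _ : ι => (volume : Measure ℝ).restrict (Ioo (0 : ℝ) 1) := by
    rw [hμ₁, hU, volume_pi, Measure.restrict_pi_pi]
  set T : (ι → ℝ) → (ι → ℝ) := fun u i => rqe (ν i) (u i) with hT
  set R : (ι → ℝ) → (ι → ℝ) := fun x i => cdf (ν i) (x i) with hR
  have hTmp : MeasurePreserving T μ₁ (Measure.pi ν) := by
    rw [hμ₁pi]
    exact measurePreserving_pi _ _ fun i => measurePreserving_rqe (ν i)
  have hR_meas : Measurable R :=
    measurable_pi_iff.2 fun i => (monotone_cdf (ν i)).measurable.comp (measurable_pi_apply i)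
  have haeU : ∀ᵐ u ∂μ₁, u ∈ U := ae_restrict_mem mU
  have haeU2 : ∀ᵐ p ∂μ₁.prod μ₁, p.1 ∈ U ∧ p.2 ∈ U := by
    filter_upwards [(Measure.quasiMeasurePreserving_fst (μ := μ₁) (ν := μ₁)).ae haeU,
      (Measure.quasiMeasurePreserving_snd (μ := μ₁) (ν := μ₁)).ae haeU] with p h1 h2 using ⟨h1, h2⟩
  have hTlat : ∀ᵐ p ∂μ₁.prod μ₁, T (p.1 ⊓ p.2) = T p.1 ⊓ T p.2 ∧ T (p.1 ⊔ p.2) = T p.1 ⊔ T p.2 := by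
    filter_upwards [haeU2] with p hp
    refine ⟨funext fun i => ?_, funext fun i => ?_⟩
    · exact (monotoneOn_rqe (ν i)).map_inf (Set.mem_univ_pi.1 hp.1 i) (Set.mem_univ_pi.1 hp.2 i)
    · exact (monotoneOn_rqe (ν i)).map_sup (Set.mem_univ_pi.1 hp.1 i) (Set.mem_univ_pi.1 hp.2 i)
  have hRlat : ∀ x ∈ (univ : Set (ι → ℝ)), ∀ y ∈ (univ : Set (ι → ℝ)),
      R (x ⊓ y) = R x ⊓ R y ∧ R (x ⊔ y) = R x ⊔ R y := fun x _ y _ =>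
    ⟨funext fun i => (monotone_cdf (ν i)).map_inf (x i) (y i),
      funext fun i => (monotone_cdf (ν i)).map_sup (x i) (y i)⟩
  have hRT : ∀ᵐ u ∂μ₁, R (T u) = u := by
    filter_upwards [haeU] with u hu
    funext i
    have hui := Set.mem_univ_pi.1 hu i
    show cdf (ν i) (rqe (ν i) (u i)) = u i
    rw [rqe_of_mem _ hui, cdf_rq_eq _ hui]
  exact hP.transport hTmp.measurable hR_meas hTlat (by rw [hTmp.map_eq]) (by rw [hTmp.map_eq])
    MeasurableSet.univ (by simp) (fun _ _ _ _ => mem_univ _) (fun _ _ _ _ => mem_univ _) hRlat hRT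

end Quantile

/-! ### Products of atomless σ-finite measures -/

section SigmaFinite

variable {ι : Type*} [Fintype ι]

/-- A finite product of s-finite measures on `ℝ` is absolutely continuous with respect to the product of the
equivalent finite measures `(ρ i).toFinite`. [folklore] -/
theorem pi_absolutelyContinuous_pi_toFinite (ρ : ι → Measure ℝ) [∀ i, SigmaFinite (ρ i)] :
    Measure.pi ρ ≪ Measure.pi fun i => (ρ i).toFinite :=
  pi_absolutelyContinuous_pi fun i => absolutelyContinuous_toFinite (ρ i)

/-- Conversely, the product of the `(ρ i).toFinite` is absolutely continuous with respect to `Measure.pi ρ`.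
[folklore] -/
theorem pi_toFinite_absolutelyContinuous_pi (ρ : ι → Measure ℝ) [∀ i, SigmaFinite (ρ i)] :
    (Measure.pi fun i => (ρ i).toFinite) ≪ Measure.pi ρ :=
  pi_absolutelyContinuous_pi fun i => toFinite_absolutelyContinuous (ρ i)

/-- **Lebesgue on `ℝ^ι` ⟹ every finite product of atomless σ-finite measures on `ℝ`.**  If some factor vanishes the
product is the zero measure; otherwise each factor is equivalent to the atomless probability measure
`(ρ i).toFinite`, and finite products of equivalent σ-finite measures are equivalent. [this work] -/
theorem HasBorelMTP2Versions.pi_of_volume (hP : HasBorelMTP2Versions (volume : Measure (ι → ℝ)))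
    (ρ : ι → Measure ℝ) [∀ i, SigmaFinite (ρ i)] [∀ i, NullSingletonClass (ρ i)] : HasBorelMTP2Versions (Measure.pi ρ) := by
  by_cases h0 : ∃ i, ρ i = 0
  · obtain ⟨i, hi⟩ := h0
    have hpi : Measure.pi ρ = 0 := by
      rw [← Measure.measure_univ_eq_zero, Measure.pi_univ]
      exact Finset.prod_eq_zero (Finset.mem_univ i) (by rw [hi]; rfl)
    rw [hpi]
    exact hasBorelMTP2Versions_zero
  · push Not at h0
    haveI : ∀ i, NeZero (ρ i) := fun i => ⟨h0 i⟩
    set ν : ι → Measure ℝ := fun i => (ρ i).toFinite with hν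
    haveI : ∀ i, IsProbabilityMeasure (ν i) := fun i => by rw [hν]; infer_instance
    haveI : ∀ i, NullSingletonClass (ν i) := fun i =>
      ⟨fun x => toFinite_absolutelyContinuous (ρ i) (measure_singleton x)⟩
    have hPν : HasBorelMTP2Versions (Measure.pi ν) :=
      (hP.restrict_openUnitCube).pi_of_restrict_openUnitCube ν
    exact hPν.of_equivalent (pi_absolutelyContinuous_pi_toFinite ρ) (pi_toFinite_absolutelyContinuous_pi ρ)

/-- Lebesgue measure restricted to ANY product set `∏ᵢ sᵢ ⊆ ℝ^ι` (e.g. an open or closed box, bounded or not)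
inherits the property from Lebesgue measure on `ℝ^ι`. [this work] -/
theorem HasBorelMTP2Versions.restrict_pi_of_volume (hP : HasBorelMTP2Versions (volume : Measure (ι → ℝ)))
    (s : ι → Set ℝ) : HasBorelMTP2Versions ((volume : Measure (ι → ℝ)).restrict (Set.pi univ s)) := by
  rw [volume_pi, Measure.restrict_pi_pi]
  exact hP.pi_of_volume fun i => (volume : Measure ℝ).restrict (s i)

/-- **Unfolded form.**  Granted the Borel-version property of Lebesgue measure on `ℝ^ι` (plan R5), for every finite
family of atomless σ-finite measures `ρᵢ` on `ℝ`, every measurable `f : ℝ^ι → [c, M]` (`0 < c`, `M < ∞`) which is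
MTP₂ on `(⊗ρᵢ) ⊗ (⊗ρᵢ)`-almost every pair has a bounded measurable version `F = f` a.e. with
`F(x) F(y) ≤ F(x ∧ y) F(x ∨ y)` for ALL `x, y`. [this work] -/
theorem exists_measurable_mtp2_version_of_ae_pi_of_volume
    (hP : HasBorelMTP2Versions (volume : Measure (ι → ℝ))) (ρ : ι → Measure ℝ) [∀ i, SigmaFinite (ρ i)]
    [∀ i, NullSingletonClass (ρ i)] (f : (ι → ℝ) → ℝ≥0∞) (hf : Measurable f) {c M : ℝ≥0∞} (hc : c ≠ 0) (hM : M ≠ ∞)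
    (hcf : ∀ x, c ≤ f x) (hfM : ∀ x, f x ≤ M)
    (hMTP : ∀ᵐ p ∂(Measure.pi ρ).prod (Measure.pi ρ), f p.1 * f p.2 ≤ f (p.1 ⊓ p.2) * f (p.1 ⊔ p.2)) :
    ∃ F : (ι → ℝ) → ℝ≥0∞, Measurable F ∧ (∃ M' : ℝ≥0∞, M' ≠ ∞ ∧ ∀ x, F x ≤ M') ∧ F =ᵐ[Measure.pi ρ] f ∧
      ∀ x y, F x * F y ≤ F (x ⊓ y) * F (x ⊔ y) :=
  hP.pi_of_volume ρ f hf c M hc hM hcf hfM hMTP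

end SigmaFinite

end Summit.CriticalPhenomena.PercolationContinuityZ3.Theorems.SahiAEFourFunctions
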